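import Summits.Ventures.CertifiedArithmetic.LowPrec.GemmTieChains

/-!
# Tie chains (II): the all-`n` lower-bound families for `E2M1² → bfloat16 / binary16`

HONEST FRAMING (venture CertifiedArithmetic / cell `pub-lowprec`): certified error envelopes and
provably optimal rounding/accumulation schemes for low-precision formats under stated cost models;
every table by two implementations; no hardware or vendor claims.

The lower-bound families of `paper/gemm.tex` (Props. `p:sandwich`, `p:limit`, `p:fp16`), products
of FP4 data exact, sequential accumulation under round-to-nearest-even (index `k` = number of
additions, length `n = k + 1`; engine: `GemmTieChains.lean`):

* `bf16_72 = (36, 36, ¼, ¼, …)` → `ŝ ≡ 72`, `|ŝ - s| / Σ|pᵢ| = (n-2)/(286+n)`;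
* `bf16_64 = (36, 24, 4, ¼, …)` → `ŝ ≡ 64`, ratio `(n-3)/(253+n) = (n-3)u/(1+(n-3)u)`, `u = 2⁻⁸`;
* `bf16_l7a = (¾, 36, 36, ¾^×56, ½, -½, …)` → `ŝ ≡ 130`, ratio `(2n-61)/(2n+341)`;
* `bf16_l7b = (4, 24, ¾, 36, ¾^×64, ½, -½, …)` → `ŝ ≡ 130`, ratio `(2n-71)/(2n+315)`;
* `bf16_l10 = (3, 36^×8, 3, 36^×6, (9/4, 2)^×64, 9/2, 4, -4, …)` → `ŝ ≡ 1040`, ratio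
  `(8n-669)/(8n+413)` — so `W(n) → 1`: there the any-order bound `(n-1)u` of Jeannerod–Rump is
  vacuous and the sharp constant `ku/(1+ku)` of Lange–Rump (hypothesis `k ≤ ½u⁻¹`) is exceeded;
* `fp16_512 = (36^×14, 8, ¼, …)` in `binary16` → `ŝ ≡ 512`, ratio `(n-15)/(2033+n)`;
* `crossovers`: the pieces change leader exactly at `n = 132, 157, 197`.

Every letter of every family is an FP4 product (`*_mem`), every family stays in range for every
length (`*_inRange`), and the ratios hold for EVERY `n` from the family's minimal length on
(`*_ratio`). These are exact replays / lower bounds for `W(n)`; that the families are OPTIMAL on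
the ranges listed in `GEMM-BOUNDS.md` is the content of the two-implementation certificate rows,
not of this file. Prefix facts by `decide +kernel`, tails by `tieChain_spec`.
-/

namespace Literature.ComputerArithmetic.FloatingPoint

namespace MiniFloat

open Finset


namespace TieChain

open Format

/-- `(36, 36, ¼, ¼, …)`: `72 + ¼` ties to `72 = 144·½` (even). [folklore] -/
def bf16_72 : ℕ → ℚ := fun k => ([36, 36] : List ℚ).getD k (1 / 4)

/-- `(36, 24, 4, ¼, ¼, …)`: `64 + ¼` ties to `64 = 128·½` (even). [folklore] -/
def bf16_64 : ℕ → ℚ := fun k => ([36, 24, 4] : List ℚ).getD k (1 / 4)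

/-- Prefix of the first level-7 family: `¾, 36, 36` (`72.75 → 73`), `¾^×56` (ties `+¼`, climb
`73 → 128`, then `128.75 → 129`), `½` (`129.5 → 130`). [folklore] -/
def l7aPre : List ℚ := [3/4, 36, 36] ++ List.replicate 56 (3/4) ++ [1/2]

/-- `(¾, 36, 36, ¾^×56, ½, -½, -½, …)`: `130 - ½` ties back to `130` (even). [folklore] -/
def bf16_l7a : ℕ → ℚ := fun k => l7aPre.getD k (-1 / 2)

/-- Prefix of the second level-7 family: `4, 24, ¾, 36` (`64.75 → 65`), `¾^×64`
(climb `65 → 129`), `½` (`129.5 → 130`). [folklore] -/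
def l7bPre : List ℚ := [4, 24, 3/4, 36] ++ List.replicate 64 (3/4) ++ [1/2]

/-- `(4, 24, ¾, 36, ¾^×64, ½, -½, -½, …)`. [folklore] -/
def bf16_l7b : ℕ → ℚ := fun k => l7bPre.getD k (-1 / 2)

/-- Prefix of the level-10 family: `3, 36^×8` (`291 → 292`), `3` (`295 → 296`), `36^×6` (to `512`),
`(9/4, 2)^×64` (at spacing `4`: `+9/4` rounds up by `1.75`, `+2` ties up by `2`; climb to `1024`),
`9/2` (`1028.5 → 1032`), `4` (`1036 → 1040`, tie to even). [folklore] -/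
def l10Pre : List ℚ :=
  [3] ++ List.replicate 8 36 ++ [3] ++ List.replicate 6 36 ++
    (List.replicate 64 [9/4, 2]).flatten ++ [9/2, 4]

/-- `(3, 36^×8, 3, 36^×6, (9/4,2)^×64, 9/2, 4, -4, -4, …)`: `1040 - 4 = 1036` ties back to
`1040 = 130·8` (even). [folklore] -/
def bf16_l10 : ℕ → ℚ := fun k => l10Pre.getD k (-4)

/-- Prefix of the `binary16` family: `36^×14, 8` (exactly `512 = 2⁹`). [folklore] -/
def fp16Pre : List ℚ := List.replicate 14 36 ++ [8]

/-- `(36^×14, 8, ¼, ¼, …)` in `binary16`: `512 + ¼` ties to `512` (even). [folklore] -/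
def fp16_512 : ℕ → ℚ := fun k => fp16Pre.getD k (1 / 4)

/-! #### Letters are products of FP4 values -/

/-- Every letter of `bf16_72` is an FP4 product. [folklore] -/
theorem bf16_72_mem (k : ℕ) : bf16_72 k ∈ piE2M1 := by
  show ([36, 36] : List ℚ).getD k (1 / 4) ∈ piE2M1
  rcases getD_mem_or [36, 36] (1 / 4) k with h | h
  · exact (by decide +kernel : ∀ a ∈ ([36, 36] : List ℚ), a ∈ piE2M1) _ h
  · rw [h]; decide +kernel

/-- Every letter of `bf16_64` is an FP4 product. [folklore] -/
theorem bf16_64_mem (k : ℕ) : bf16_64 k ∈ piE2M1 := by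
  show ([36, 24, 4] : List ℚ).getD k (1 / 4) ∈ piE2M1
  rcases getD_mem_or [36, 24, 4] (1 / 4) k with h | h
  · exact (by decide +kernel : ∀ a ∈ ([36, 24, 4] : List ℚ), a ∈ piE2M1) _ h
  · rw [h]; decide +kernel

/-- Every letter of `bf16_l7a` is an FP4 product. [folklore] -/
theorem bf16_l7a_mem (k : ℕ) : bf16_l7a k ∈ piE2M1 := by
  show l7aPre.getD k (-1 / 2) ∈ piE2M1
  rcases getD_mem_or l7aPre (-1 / 2) k with h | h
  · exact (by decide +kernel : ∀ a ∈ l7aPre, a ∈ piE2M1) _ h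
  · rw [h]; decide +kernel

/-- Every letter of `bf16_l7b` is an FP4 product. [folklore] -/
theorem bf16_l7b_mem (k : ℕ) : bf16_l7b k ∈ piE2M1 := by
  show l7bPre.getD k (-1 / 2) ∈ piE2M1
  rcases getD_mem_or l7bPre (-1 / 2) k with h | h
  · exact (by decide +kernel : ∀ a ∈ l7bPre, a ∈ piE2M1) _ h
  · rw [h]; decide +kernel

/-- Every letter of `bf16_l10` is an FP4 product. [folklore] -/
theorem bf16_l10_mem (k : ℕ) : bf16_l10 k ∈ piE2M1 := by
  show l10Pre.getD k (-4) ∈ piE2M1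
  rcases getD_mem_or l10Pre (-4) k with h | h
  · exact (by decide +kernel : ∀ a ∈ l10Pre, a ∈ piE2M1) _ h
  · rw [h]; decide +kernel

/-- Every letter of `fp16_512` is an FP4 product. [folklore] -/
theorem fp16_512_mem (k : ℕ) : fp16_512 k ∈ piE2M1 := by
  show fp16Pre.getD k (1 / 4) ∈ piE2M1
  rcases getD_mem_or fp16Pre (1 / 4) k with h | h
  · exact (by decide +kernel : ∀ a ∈ fp16Pre, a ∈ piE2M1) _ h
  · rw [h]; decide +kernel

/-! #### All-length values: accumulator, exact sum, mass, range -/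

/-- `bf16_72`: for every `k ≥ 1`, `ŝₖ = 72`, `sₖ = Lₖ = 72 + (k-1)/4`. [folklore] -/
theorem bf16_72_spec : ∀ k, 1 ≤ k → (seqSum BFloat16 bf16_72 k).toRat = 72 ∧
    ∑ i ∈ range (k + 1), bf16_72 i = 72 + ((k : ℚ) - 1) * (1 / 4) ∧
    ∑ i ∈ range (k + 1), |bf16_72 i| = 72 + ((k : ℚ) - 1) * (1 / 4) := by
  have h := tieChain_spec (α := BFloat16) bf16_72 1 (1 / 4) 72 72 72 (getD_tail [36, 36] _ rfl)
    (by decide +kernel) (by decide +kernel) (by decide +kernel) (by decide +kernel)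
  intro k hk; obtain ⟨h1, h2, h3⟩ := h k hk
  refine ⟨h1, by simpa using h2, ?_⟩
  rw [h3, abs_of_pos (by norm_num)]; ring

/-- `bf16_72` never leaves the finite range of `bfloat16`. [folklore] -/
theorem bf16_72_inRange : ∀ k, InRange BFloat16 bf16_72 k :=
  tieChain_inRange (α := BFloat16) bf16_72 1 (1 / 4) 72 (getD_tail [36, 36] _ rfl)
    (by decide +kernel) (by decide +kernel) (by unfold InRange; decide +kernel) (by decide +kernel)

/-- `bf16_64`: for every `k ≥ 2`, `ŝₖ = 64`, `sₖ = Lₖ = 64 + (k-2)/4`. [folklore] -/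
theorem bf16_64_spec : ∀ k, 2 ≤ k → (seqSum BFloat16 bf16_64 k).toRat = 64 ∧
    ∑ i ∈ range (k + 1), bf16_64 i = 64 + ((k : ℚ) - 2) * (1 / 4) ∧
    ∑ i ∈ range (k + 1), |bf16_64 i| = 64 + ((k : ℚ) - 2) * (1 / 4) := by
  have h := tieChain_spec (α := BFloat16) bf16_64 2 (1 / 4) 64 64 64 (getD_tail [36, 24, 4] _ rfl)
    (by decide +kernel) (by decide +kernel) (by decide +kernel) (by decide +kernel)
  intro k hk; obtain ⟨h1, h2, h3⟩ := h k hk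
  refine ⟨h1, by simpa using h2, ?_⟩
  rw [h3, abs_of_pos (by norm_num)]; ring

/-- `bf16_64` never leaves the finite range of `bfloat16`. [folklore] -/
theorem bf16_64_inRange : ∀ k, InRange BFloat16 bf16_64 k :=
  tieChain_inRange (α := BFloat16) bf16_64 2 (1 / 4) 64 (getD_tail [36, 24, 4] _ rfl)
    (by decide +kernel) (by decide +kernel) (by unfold InRange; decide +kernel) (by decide +kernel)

/-- `bf16_l7a`: for every `k ≥ 59`, `ŝₖ = 130`, `sₖ = 115.25 - (k-59)/2`, `Lₖ = 115.25 + (k-59)/2`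
(the prefix error `130 - 115.25 = +14.75` has the sign of every later error `+½`). [folklore] -/
theorem bf16_l7a_spec : ∀ k, 59 ≤ k → (seqSum BFloat16 bf16_l7a k).toRat = 130 ∧
    ∑ i ∈ range (k + 1), bf16_l7a i = 461 / 4 + ((k : ℚ) - 59) * (-1 / 2) ∧
    ∑ i ∈ range (k + 1), |bf16_l7a i| = 461 / 4 + ((k : ℚ) - 59) * (1 / 2) := by
  have h := tieChain_spec (α := BFloat16) bf16_l7a 59 (-1 / 2) 130 (461 / 4) (461 / 4)
    (getD_tail l7aPre _ rfl)
    (by decide +kernel) (by decide +kernel) (by decide +kernel) (by decide +kernel)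
  intro k hk; obtain ⟨h1, h2, h3⟩ := h k hk
  refine ⟨h1, by simpa using h2, ?_⟩
  rw [h3, abs_of_neg (by norm_num)]; ring

/-- `bf16_l7a` never leaves the finite range of `bfloat16`. [folklore] -/
theorem bf16_l7a_inRange : ∀ k, InRange BFloat16 bf16_l7a k :=
  tieChain_inRange (α := BFloat16) bf16_l7a 59 (-1 / 2) 130 (getD_tail l7aPre _ rfl)
    (by decide +kernel) (by decide +kernel) (by unfold InRange; decide +kernel) (by decide +kernel)

/-- `bf16_l7b`: for every `k ≥ 68`, `ŝₖ = 130`, `sₖ = 113.25 - (k-68)/2`, `Lₖ = 113.25 + (k-68)/2`.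
[folklore] -/
theorem bf16_l7b_spec : ∀ k, 68 ≤ k → (seqSum BFloat16 bf16_l7b k).toRat = 130 ∧
    ∑ i ∈ range (k + 1), bf16_l7b i = 453 / 4 + ((k : ℚ) - 68) * (-1 / 2) ∧
    ∑ i ∈ range (k + 1), |bf16_l7b i| = 453 / 4 + ((k : ℚ) - 68) * (1 / 2) := by
  have h := tieChain_spec (α := BFloat16) bf16_l7b 68 (-1 / 2) 130 (453 / 4) (453 / 4)
    (getD_tail l7bPre _ rfl)
    (by decide +kernel) (by decide +kernel) (by decide +kernel) (by decide +kernel)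
  intro k hk; obtain ⟨h1, h2, h3⟩ := h k hk
  refine ⟨h1, by simpa using h2, ?_⟩
  rw [h3, abs_of_neg (by norm_num)]; ring

/-- `bf16_l7b` never leaves the finite range of `bfloat16`. [folklore] -/
theorem bf16_l7b_inRange : ∀ k, InRange BFloat16 bf16_l7b k :=
  tieChain_inRange (α := BFloat16) bf16_l7b 68 (-1 / 2) 130 (getD_tail l7bPre _ rfl)
    (by decide +kernel) (by decide +kernel) (by unfold InRange; decide +kernel) (by decide +kernel)

/-- `bf16_l10`: for every `k ≥ 145`, `ŝₖ = 1040`, `sₖ = 790.5 - 4(k-145)`, `Lₖ = 790.5 + 4(k-145)`.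
[folklore] -/
theorem bf16_l10_spec : ∀ k, 145 ≤ k → (seqSum BFloat16 bf16_l10 k).toRat = 1040 ∧
    ∑ i ∈ range (k + 1), bf16_l10 i = 1581 / 2 + ((k : ℚ) - 145) * (-4) ∧
    ∑ i ∈ range (k + 1), |bf16_l10 i| = 1581 / 2 + ((k : ℚ) - 145) * 4 := by
  have h := tieChain_spec (α := BFloat16) bf16_l10 145 (-4) 1040 (1581 / 2) (1581 / 2)
    (getD_tail l10Pre _ rfl)
    (by decide +kernel) (by decide +kernel) (by decide +kernel) (by decide +kernel)
  intro k hk; obtain ⟨h1, h2, h3⟩ := h k hk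
  refine ⟨h1, by simpa using h2, ?_⟩
  rw [h3, abs_of_neg (by norm_num)]; ring

/-- `bf16_l10` never leaves the finite range of `bfloat16`. [folklore] -/
theorem bf16_l10_inRange : ∀ k, InRange BFloat16 bf16_l10 k :=
  tieChain_inRange (α := BFloat16) bf16_l10 145 (-4) 1040 (getD_tail l10Pre _ rfl)
    (by decide +kernel) (by decide +kernel) (by unfold InRange; decide +kernel) (by decide +kernel)

/-- `fp16_512` (`binary16`): for every `k ≥ 14`, `ŝₖ = 512`, `sₖ = Lₖ = 512 + (k-14)/4`.
[folklore] -/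
theorem fp16_512_spec : ∀ k, 14 ≤ k → (seqSum Binary16 fp16_512 k).toRat = 512 ∧
    ∑ i ∈ range (k + 1), fp16_512 i = 512 + ((k : ℚ) - 14) * (1 / 4) ∧
    ∑ i ∈ range (k + 1), |fp16_512 i| = 512 + ((k : ℚ) - 14) * (1 / 4) := by
  have h := tieChain_spec (α := Binary16) fp16_512 14 (1 / 4) 512 512 512 (getD_tail fp16Pre _ rfl)
    (by decide +kernel) (by decide +kernel) (by decide +kernel) (by decide +kernel)
  intro k hk; obtain ⟨h1, h2, h3⟩ := h k hk
  refine ⟨h1, by simpa using h2, ?_⟩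
  rw [h3, abs_of_pos (by norm_num)]; ring

/-- `fp16_512` never leaves the finite range of `binary16`. [folklore] -/
theorem fp16_512_inRange : ∀ k, InRange Binary16 fp16_512 k :=
  tieChain_inRange (α := Binary16) fp16_512 14 (1 / 4) 512 (getD_tail fp16Pre _ rfl)
    (by decide +kernel) (by decide +kernel) (by unfold InRange; decide +kernel) (by decide +kernel)

/-! #### The relative errors `|ŝ - s| / Σ|pᵢ|` for every length `n` (= `k + 1` letters) -/

/-- `(36, 36, ¼, …)`, length `n ≥ 2`: `|ŝ - s| / L = (n-2)/(286+n)`. [folklore] -/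
theorem bf16_72_ratio (n : ℕ) (hn : 2 ≤ n) :
    |(seqSum BFloat16 bf16_72 (n - 1)).toRat - ∑ i ∈ range n, bf16_72 i| /
      ∑ i ∈ range n, |bf16_72 i| = ((n : ℚ) - 2) / (286 + n) := by
  obtain ⟨k, rfl⟩ : ∃ k, n = k + 1 := ⟨n - 1, by omega⟩
  obtain ⟨h1, h2, h3⟩ := bf16_72_spec k (by omega)
  have hk : (1 : ℚ) ≤ k := by exact_mod_cast (show 1 ≤ k by omega)
  rw [Nat.add_sub_cancel, h1, h2, h3, abs_of_nonpos (by linarith),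
    div_eq_div_iff (by linarith) (by positivity)]
  push_cast; ring

/-- `(36, 24, 4, ¼, …)`, length `n ≥ 3`: `|ŝ - s| / L = (n-3)/(253+n)` (`= (n-3)u/(1+(n-3)u)`,
`u = 2⁻⁸`: the Lange–Rump sharp constant for `k = n-3` roundings, here for EVERY `n`). [folklore] -/
theorem bf16_64_ratio (n : ℕ) (hn : 3 ≤ n) :
    |(seqSum BFloat16 bf16_64 (n - 1)).toRat - ∑ i ∈ range n, bf16_64 i| /
      ∑ i ∈ range n, |bf16_64 i| = ((n : ℚ) - 3) / (253 + n) := by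
  obtain ⟨k, rfl⟩ : ∃ k, n = k + 1 := ⟨n - 1, by omega⟩
  obtain ⟨h1, h2, h3⟩ := bf16_64_spec k (by omega)
  have hk : (2 : ℚ) ≤ k := by exact_mod_cast (show 2 ≤ k by omega)
  rw [Nat.add_sub_cancel, h1, h2, h3, abs_of_nonpos (by linarith),
    div_eq_div_iff (by linarith) (by positivity)]
  push_cast; ring

/-- Level-7 family (a), length `n ≥ 60`: `|ŝ - s| / L = (2n-61)/(2n+341)`. [folklore] -/
theorem bf16_l7a_ratio (n : ℕ) (hn : 60 ≤ n) :
    |(seqSum BFloat16 bf16_l7a (n - 1)).toRat - ∑ i ∈ range n, bf16_l7a i| /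
      ∑ i ∈ range n, |bf16_l7a i| = (2 * (n : ℚ) - 61) / (2 * n + 341) := by
  obtain ⟨k, rfl⟩ : ∃ k, n = k + 1 := ⟨n - 1, by omega⟩
  obtain ⟨h1, h2, h3⟩ := bf16_l7a_spec k (by omega)
  have hk : (59 : ℚ) ≤ k := by exact_mod_cast (show 59 ≤ k by omega)
  rw [Nat.add_sub_cancel, h1, h2, h3, abs_of_nonneg (by linarith),
    div_eq_div_iff (by linarith) (by positivity)]
  push_cast; ring

/-- Level-7 family (b), length `n ≥ 69`: `|ŝ - s| / L = (2n-71)/(2n+315)`. [folklore] -/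
theorem bf16_l7b_ratio (n : ℕ) (hn : 69 ≤ n) :
    |(seqSum BFloat16 bf16_l7b (n - 1)).toRat - ∑ i ∈ range n, bf16_l7b i| /
      ∑ i ∈ range n, |bf16_l7b i| = (2 * (n : ℚ) - 71) / (2 * n + 315) := by
  obtain ⟨k, rfl⟩ : ∃ k, n = k + 1 := ⟨n - 1, by omega⟩
  obtain ⟨h1, h2, h3⟩ := bf16_l7b_spec k (by omega)
  have hk : (68 : ℚ) ≤ k := by exact_mod_cast (show 68 ≤ k by omega)
  rw [Nat.add_sub_cancel, h1, h2, h3, abs_of_nonneg (by linarith),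
    div_eq_div_iff (by linarith) (by positivity)]
  push_cast; ring

/-- Level-10 family, length `n ≥ 146`: `|ŝ - s| / L = (8n-669)/(8n+413) → 1`. [folklore] -/
theorem bf16_l10_ratio (n : ℕ) (hn : 146 ≤ n) :
    |(seqSum BFloat16 bf16_l10 (n - 1)).toRat - ∑ i ∈ range n, bf16_l10 i| /
      ∑ i ∈ range n, |bf16_l10 i| = (8 * (n : ℚ) - 669) / (8 * n + 413) := by
  obtain ⟨k, rfl⟩ : ∃ k, n = k + 1 := ⟨n - 1, by omega⟩
  obtain ⟨h1, h2, h3⟩ := bf16_l10_spec k (by omega)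
  have hk : (145 : ℚ) ≤ k := by exact_mod_cast (show 145 ≤ k by omega)
  rw [Nat.add_sub_cancel, h1, h2, h3, abs_of_nonneg (by linarith),
    div_eq_div_iff (by linarith) (by positivity)]
  push_cast; ring

/-- `(36^×14, 8, ¼, …)` in `binary16`, length `n ≥ 15`: `|ŝ - s| / L = (n-15)/(2033+n)`
(`= (n-15)u/(1+(n-15)u)`, `u = 2⁻¹¹`). [folklore] -/
theorem fp16_512_ratio (n : ℕ) (hn : 15 ≤ n) :
    |(seqSum Binary16 fp16_512 (n - 1)).toRat - ∑ i ∈ range n, fp16_512 i| /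
      ∑ i ∈ range n, |fp16_512 i| = ((n : ℚ) - 15) / (2033 + n) := by
  obtain ⟨k, rfl⟩ : ∃ k, n = k + 1 := ⟨n - 1, by omega⟩
  obtain ⟨h1, h2, h3⟩ := fp16_512_spec k (by omega)
  have hk : (14 : ℚ) ≤ k := by exact_mod_cast (show 14 ≤ k by omega)
  rw [Nat.add_sub_cancel, h1, h2, h3, abs_of_nonpos (by linarith),
    div_eq_div_iff (by linarith) (by positivity)]
  push_cast; ring

/-- Crossovers of the `bfloat16` pieces: the level-7 (a) ratio exceeds `(n-3)/(253+n)` exactly from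
`n = 132` (`n > 131`), (b) exceeds (a) exactly from `n = 157` (`n > 1249/8`), and the level-10 ratio
exceeds (b) exactly from `n = 197` (`n > 589/3`), as rational functions of `n ≥ 69`. [folklore] -/
theorem crossovers (n : ℚ) (hn : 69 ≤ n) :
    ((n - 3) / (253 + n) < (2 * n - 61) / (2 * n + 341) ↔ 131 < n) ∧
    ((2 * n - 61) / (2 * n + 341) < (2 * n - 71) / (2 * n + 315) ↔ 1249 / 8 < n) ∧
    ((2 * n - 71) / (2 * n + 315) < (8 * n - 669) / (8 * n + 413) ↔ 589 / 3 < n) := by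
  refine ⟨?_, ?_, ?_⟩ <;> rw [div_lt_div_iff₀ (by linarith) (by linarith)] <;>
    constructor <;> intro h <;> nlinarith

end TieChain

end MiniFloat

end Literature.ComputerArithmetic.FloatingPoint
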